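import Summits.CriticalPhenomena.PercolationContinuityZ3.Theorems.PercNearOneGluingNoHeavyLowerTailCILTwoPortFewRelays
import HarnessLib

/-!
# `NoHeavyLowerTail` (stmt-CriticalPhenomena-4575) — two pendant stars, one with at most two ports besides the champion

Support file (prover `prim-hp-2`, deletion–contraction / pivotal-edge line; `--supports stmt-CriticalPhenomena-4575`).
No definitions, no named facts, no sorries.  Notation as in `…CILTwoPortLevelTwo` / `…CILTwoPortFewRelays`.

`…CILTwoPortFewRelays` settles the two-sided core `CS_w({s₁,s₂}, q)` when `s₂` has its ports among two relays `c ≠ d`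
(`tps_twoPort_of_fewRelays`, champion `q` anywhere).  The exhaustive `(5,2)` census of prim-hp-2 (kit j049123) found that every
instance of the two-pendant-stars observer not covered by the earlier proved classes has a star with exactly two ports BESIDES the
witness — e.g. `s₂` with the three ports `q, c, d`, `q` the champion.  This file adds that case by one more pivot:

* `tps_portsWithinWitnessPair` — if the positive-weight pairs at `s₂` end in `q`, `c` or `d` (`q` the champion of `A`, `c ≠ d` relays)
  then `CS_w({s₁,s₂}, q)`, for `j ≤ 2 ∨ |A| ≤ j + 3`.  Proof: if `q ∈ {c,d}` this is `tps_twoPort_of_fewRelays`; otherwise pivot on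
  the pair `q–s₂` (`stub_oneBondDecomp_k15`): both events force it closed, so the glued branch is null, and in the deleted branch
  `s₂` has its ports among `c, d`, the champion survives (`CutObserver.champion_of_erase_own_edge`), and
  `setCS_pair_twoPort_of_fewRelays` applies.
* `cil_twoPendantStars_portsWithinWitnessPair` — the observer-level statement (conclusion of `stub_cumulativeIsolation`) at every
  observer whose hull is `{o, s₁, s₂}` with non-adjacent pendant relay-stars `s₁, s₂`, the ports of `s₂` within `{q, c, d}` for the
  `H`-champion `q`; `j ≤ 2 ∨ |A| ≤ j + 3` (every `j` at `|A| ≤ 6`).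
-/

noncomputable section

namespace Summit.CriticalPhenomena.PercolationContinuityZ3.Theorems

open MeasureTheory Set Literature.Probability.LatticeModels Literature.Probability.Percolation
open scoped Classical BigOperators

variable {n : ℕ}

open CutObserver in
/-- **TPS when the ports of `s₂` lie within `{q, c, d}`, `q` the champion** (`j ≤ 2` or `|A| ≤ j + 3`).  `s₁ ≠ s₂` non-relays; the
positive-weight pairs at `s₁` end in relays (at least one), those at `s₂` in `q`, `c` or `d` (`c ≠ d` relays); `q ∈ A` a champion of
`A` in `w`.  Then `CS_w({s₁,s₂}, q)`. [cite: VandenbergHaggstromKahn2005, Thm. 1.5 (p. 7)] -/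
theorem tps_portsWithinWitnessPair (w : Sym2 (Fin n) → unitInterval) (A : Finset (Fin n)) (s₁ s₂ c d q : Fin n) (j : ℕ)
    (hj : j ≤ 2 ∨ A.card ≤ j + 3) (hs₁A : s₁ ∉ A) (hs₂A : s₂ ∉ A) (h12 : s₁ ≠ s₂) (hcA : c ∈ A) (hdA : d ∈ A) (hcd : c ≠ d)
    (hqA : q ∈ A) (hobs₁ : ∀ v, w s(s₁, v) ≠ 0 → v ∈ A) (hne₁ : ∃ v, w s(s₁, v) ≠ 0)
    (hobs₂ : ∀ v, v ≠ s₂ → w s(s₂, v) ≠ 0 → v = q ∨ v = c ∨ v = d)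
    (hchamp : ∀ a ∈ A, (prodBernoulli w).real {ω : BondConfig (Fin n) | (A.filter fun z => ω ∈ openConn a z).card ≤ j} ≤
      (prodBernoulli w).real {ω : BondConfig (Fin n) | (A.filter fun z => ω ∈ openConn q z).card ≤ j}) :
    (prodBernoulli w).real {ω : BondConfig (Fin n) | (∀ x ∈ ({s₁, s₂} : Finset (Fin n)), ω ∉ openConn q x) ∧
        1 ≤ (A.filter fun z => ∃ x ∈ ({s₁, s₂} : Finset (Fin n)), ω ∈ openConn x z).card ∧
        (A.filter fun z => ∃ x ∈ ({s₁, s₂} : Finset (Fin n)), ω ∈ openConn x z).card ≤ j} ≤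
      (prodBernoulli w).real {ω : BondConfig (Fin n) | (∀ x ∈ ({s₁, s₂} : Finset (Fin n)), ω ∉ openConn q x) ∧
        (A.filter fun z => ω ∈ openConn q z).card ≤ j} := by
  haveI : ∀ u : Sym2 (Fin n) → unitInterval, IsProbabilityMeasure (prodBernoulli u) := fun u => inferInstance
  -- `q ∈ {c, d}`: the ports of `s₂` are among `c, d`
  by_cases hqc : q = c
  · subst hqc
    exact tps_twoPort_of_fewRelays w A s₁ s₂ q d q j hj hs₁A hs₂A h12 hqA hdA hcd hqA hobs₁ hne₁
      (fun v hv h => by rcases hobs₂ v hv h with h' | h' | h' <;> simp [h']) hchamp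
  by_cases hqd : q = d
  · subst hqd
    exact tps_twoPort_of_fewRelays w A s₁ s₂ c q q j hj hs₁A hs₂A h12 hcA hqA hcd hqA hobs₁ hne₁
      (fun v hv h => by rcases hobs₂ v hv h with h' | h' | h' <;> simp [h']) hchamp
  -- `q ∉ {c, d}`: pivot on the pair `q–s₂`
  have hqs : q ≠ s₂ := fun h => hs₂A (h ▸ hqA)
  set e : Sym2 (Fin n) := s(q, s₂) with he
  have hee : s(s₂, q) = e := Sym2.eq_swap
  set LS := {ω : BondConfig (Fin n) | (∀ x ∈ ({s₁, s₂} : Finset (Fin n)), ω ∉ openConn q x) ∧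
    1 ≤ (A.filter fun z => ∃ x ∈ ({s₁, s₂} : Finset (Fin n)), ω ∈ openConn x z).card ∧
    (A.filter fun z => ∃ x ∈ ({s₁, s₂} : Finset (Fin n)), ω ∈ openConn x z).card ≤ j} with hLS
  set RS := {ω : BondConfig (Fin n) | (∀ x ∈ ({s₁, s₂} : Finset (Fin n)), ω ∉ openConn q x) ∧
    (A.filter fun z => ω ∈ openConn q z).card ≤ j} with hRS
  have hsub : ∀ ω : BondConfig (Fin n), (∀ x ∈ ({s₁, s₂} : Finset (Fin n)), ω ∉ openConn q x) → e ∉ ω := by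
    intro ω h hopen
    have hadj : (openGraph ω).Adj q s₂ := by rw [openGraph, SimpleGraph.fromEdgeSet_adj]; exact ⟨hopen, hqs⟩
    exact h s₂ (by simp) hadj.reachable
  have hnull : ∀ S : Set (BondConfig (Fin n)), (∀ ω ∈ S, e ∉ ω) →
      (prodBernoulli (Function.update w e 1)).real S = 0 := by
    intro S hS
    refine le_antisymm ?_ measureReal_nonneg
    calc (prodBernoulli (Function.update w e 1)).real S
        ≤ (prodBernoulli (Function.update w e 1)).real {ω : BondConfig (Fin n) | e ∉ ω} :=
          measureReal_mono (fun ω hω => hS ω hω) (measure_ne_top _ _)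
      _ = 0 := by rw [prodBernoulli_real_setOf_notMem, Function.update_self]; simp
  have hL1 : (prodBernoulli (Function.update w e 1)).real LS = 0 := hnull LS fun ω hω => hsub ω hω.1
  have hR1 : (prodBernoulli (Function.update w e 1)).real RS = 0 := hnull RS fun ω hω => hsub ω hω.1
  have hdecL := stub_oneBondDecomp_k15 n w e LS
  have hdecR := stub_oneBondDecomp_k15 n w e RS
  rw [hL1] at hdecL
  rw [hR1] at hdecR
  set w₀ : Sym2 (Fin n) → unitInterval := Function.update w e 0 with hw₀
  have hy0 : 0 ≤ 1 - (w e : ℝ) := sub_nonneg.2 (w e).2.2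
  by_cases hy1 : (w e : ℝ) < 1
  swap
  · have hwe : (w e : ℝ) = 1 := le_antisymm (w e).2.2 (not_lt.1 hy1)
    rw [hdecL, hwe]
    have : 0 ≤ (prodBernoulli w).real RS := measureReal_nonneg
    linarith
  · suffices h0 : (prodBernoulli w₀).real LS ≤ (prodBernoulli w₀).real RS by
      rw [hdecL, hdecR]
      have := mul_le_mul_of_nonneg_left h0 hy0
      linarith
    have hw₀e : w₀ e = 0 := by rw [hw₀, Function.update_self]
    have hw₀_ne : ∀ f : Sym2 (Fin n), f ≠ e → w₀ f = w f := fun f hf => by rw [hw₀, Function.update_of_ne hf]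
    -- the champion survives deleting its own pair
    have hchamp₀ := champion_of_erase_own_edge w A q s₂ j hqs hy1 hchamp
    -- in `w₀` the ports of `s₂` are among `c, d`, those of `s₁` are unchanged
    have hobs₂₀ : ∀ y, y ≠ s₂ → w₀ s(s₂, y) ≠ 0 → y = c ∨ y = d := by
      intro y hy h
      by_cases hyq : y = q
      · subst hyq; rw [hee, hw₀e] at h; exact absurd rfl h
      rw [hw₀_ne _ (fun h' => hyq (by rw [← hee] at h'; exact Sym2.congr_right.1 h'))] at h
      rcases hobs₂ y hy h with h' | h' | h'
      · exact absurd h' hyq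
      · exact Or.inl h'
      · exact Or.inr h'
    have h1e : ∀ v, s(s₁, v) ≠ e := by
      intro v h
      have : s₁ ∈ e := h ▸ Sym2.mem_mk_left s₁ v
      rcases Sym2.mem_iff.1 this with h' | h'
      · exact hs₁A (h' ▸ hqA)
      · exact h12 h'
    have hobs₁₀ : ∀ v, w₀ s(s₁, v) ≠ 0 → v ∈ A := fun v hv => hobs₁ v (by rwa [hw₀_ne _ (h1e v)] at hv)
    exact setCS_pair_twoPort_of_fewRelays w₀ A s₁ s₂ c d q j hj hs₁A hs₂A h12 hcA hdA hcd hqA hqc hqd hobs₁₀ hobs₂₀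
      (fun a ha _ => hchamp₀ a ha)

open CutObserver SubStar TwoPendantStars in
/-- **CIL for the two-pendant-stars observer when one star's ports lie within `{q, c, d}`, `q` the champion** (`j ≤ 2` or
`|A| ≤ j + 3`).  Let `o ∉ A` have positive-weight neighbours only among the relays and two non-relays `s₁ ≠ s₂`; apart from `o`,
`s₁` has only relay neighbours (at least one) and `s₂` has only relay neighbours, all among `q, c, d` (`c ≠ d` relays, `q ∈ A` an
`H`-champion, `H` = no edge at `o`); `j ≤ 2` or `|A| ≤ j + 3` (at the crux ladder `|A| = 5`: every `j`).  Then
`μ_w{1 ≤ N ≤ j} ≤ μ_w{|π(q)| ≤ j}` — the conclusion of `stub_cumulativeIsolation` (crux `NoHeavyLowerTail`, stmt-CriticalPhenomena-4575)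
with the witness `q` — i.e. the two-pendant-stars class at every port shape in which one star has at most two ports BESIDES THE
CHAMPION.  Proof: `cil_twoPendantStars_of_TPS` (star transfer) + `tps_portsWithinWitnessPair` in the weights with the pairs at `o`
switched off. [cite: VandenbergHaggstromKahn2005, Thm. 1.5 (p. 7); KozmaNitzan2024, Lemma 5 (p. 13) — star decomposition] -/
theorem cil_twoPendantStars_portsWithinWitnessPair (w : Sym2 (Fin n) → unitInterval) (A : Finset (Fin n)) (o s₁ s₂ c d q : Fin n)
    (j : ℕ) (hj : j ≤ 2 ∨ A.card ≤ j + 3) (hoA : o ∉ A) (hs₁A : s₁ ∉ A) (hs₂A : s₂ ∉ A) (hs₁o : s₁ ≠ o) (hs₂o : s₂ ≠ o) (h12 : s₁ ≠ s₂)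
    (hcA : c ∈ A) (hdA : d ∈ A) (hcd : c ≠ d)
    (hobs : ∀ v, w s(o, v) ≠ 0 → v ∈ A ∨ v = s₁ ∨ v = s₂)
    (hobs₁ : ∀ v, v ≠ o → w s(s₁, v) ≠ 0 → v ∈ A) (hobs₂ : ∀ v, v ≠ o → w s(s₂, v) ≠ 0 → v ∈ A)
    (hthree : ∀ v, v ≠ o → v ≠ s₂ → w s(s₂, v) ≠ 0 → v = q ∨ v = c ∨ v = d)
    (hne₁ : ∃ v ∈ A, w s(s₁, v) ≠ 0) (hne₂ : ∃ v ∈ A, w s(s₂, v) ≠ 0) (hqA : q ∈ A)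
    (hchamp : ∀ a ∈ A,
      (prodBernoulli w).real {ω : BondConfig (Fin n) |
          (A.filter fun z => (openGraph (ω ∩ {e | o ∉ e})).Reachable a z).card ≤ j} ≤
        (prodBernoulli w).real {ω : BondConfig (Fin n) |
          (A.filter fun z => (openGraph (ω ∩ {e | o ∉ e})).Reachable q z).card ≤ j}) :
    (prodBernoulli w).real {ω : BondConfig (Fin n) |
        1 ≤ (A.filter fun x => ω ∈ openConn o x).card ∧ (A.filter fun x => ω ∈ openConn o x).card ≤ j} ≤
      (prodBernoulli w).real {ω : BondConfig (Fin n) | (A.filter fun x => ω ∈ openConn q x).card ≤ j} := by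
  set wo : Sym2 (Fin n) → unitInterval := fun e => if e ∈ {e : Sym2 (Fin n) | o ∉ e} then w e else 0 with hwo
  have hwo_of : ∀ u v : Fin n, o ∉ s(u, v) → wo s(u, v) = w s(u, v) := by
    intro u v h; simp only [hwo, Set.mem_setOf_eq, h, not_false_eq_true, if_true]
  have hwo_ne : ∀ u v : Fin n, wo s(u, v) ≠ 0 → o ∉ s(u, v) ∧ w s(u, v) ≠ 0 := by
    intro u v h
    by_cases ho : o ∉ s(u, v)
    · exact ⟨ho, by rwa [hwo_of u v ho] at h⟩
    · exfalso; apply h; simp only [hwo, Set.mem_setOf_eq, ho, if_false]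
  have hobs₁' : ∀ v, wo s(s₁, v) ≠ 0 → v ∈ A := by
    intro v hv
    obtain ⟨ho, hw⟩ := hwo_ne s₁ v hv
    exact hobs₁ v (fun h => ho (h ▸ Sym2.mem_mk_right s₁ v)) hw
  have hne₁' : ∃ v, wo s(s₁, v) ≠ 0 := by
    obtain ⟨v, hvA, hv⟩ := hne₁
    refine ⟨v, ?_⟩
    have ho : o ∉ s(s₁, v) := by
      rw [Sym2.mem_iff, not_or]; exact ⟨fun h => hs₁o h.symm, fun h => hoA (h ▸ hvA)⟩
    rw [hwo_of s₁ v ho]; exact hv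
  have hobs₂' : ∀ v, v ≠ s₂ → wo s(s₂, v) ≠ 0 → v = q ∨ v = c ∨ v = d := by
    intro v hv2 hv
    obtain ⟨ho, hw⟩ := hwo_ne s₂ v hv
    exact hthree v (fun h => ho (h ▸ Sym2.mem_mk_right s₂ v)) hv2 hw
  have hchamp' : ∀ a ∈ A, (prodBernoulli wo).real {ω : BondConfig (Fin n) | (A.filter fun z => ω ∈ openConn a z).card ≤ j} ≤
      (prodBernoulli wo).real {ω : BondConfig (Fin n) | (A.filter fun z => ω ∈ openConn q z).card ≤ j} := by
    intro a ha
    have h := hchamp a ha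
    rw [real_lightness_avoid w A o a j, real_lightness_avoid w A o q j] at h
    exact h
  have hTPS := tps_portsWithinWitnessPair wo A s₁ s₂ c d q j hj hs₁A hs₂A h12 hcA hdA hcd hqA hobs₁' hne₁' hobs₂' hchamp'
  exact cil_twoPendantStars_of_TPS w A o s₁ s₂ q j hoA hs₁A hs₂A hs₁o hs₂o hobs hobs₁ hobs₂ hne₁ hne₂ hqA hchamp hTPS

end Summit.CriticalPhenomena.PercolationContinuityZ3.Theorems

end
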